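import Summits.AtomisticToContinuum.HydrodynamicLimit.Theses.AntiMazurCoboundaries
import Summits.AtomisticToContinuum.HydrodynamicLimit.Theorems.CellForecastPressureDecay.Negative.PerParticle
import Literature.Probability.LatticeModels.PolymerGas
import Literature.Analysis.Complex.VitaliConvergence
import HarnessLib.Audit

/-!
# Line `tilt-analyticity-transfer` for the crux `CellForecastPressureDecay` (stmt-AtomisticToContinuum-13915)

Route `AntiMazurCoboundaries`, crux #6 (the N-free core):
`∃ σ₀ ∀ σ<σ₀ ∃ κ ∀ g (continuous, |g| ≤ κ, g ⊥ span(1,v,|v|²)) ∀ δ ∃ T ∃ R₀ ∀ R ≥ R₀ ∃ L₀ ∀ L ≥ L₀ ∀ n ≤ 2L³ ∀ Ψ ∀ |c| ≤ 1: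
 ∫⁻ exp(2c Σᵢ T⁻¹∫₀ᵀ g(forecast velocity of i)) dP_{n,L} ≤ e^{δ L³}`.

## The lever (crux idea `tilt-analyticity-transfer`, triage r1: pass ×3)

COMPLEXIFY THE TILT. Write the left side as the value at real `c` of the entire function
`Z(c) = tiltZ … c = ∫ exp(2c·Σᵢ aᵢ) dP_{n,L}` (`aᵢ = windowAvg`, `|aᵢ| ≤ κ`). The crux is
`sup_{|c|≤1} L⁻³ log Z(c) ≤ δ` once `T` is large. Split it into
* (i) UNIFORM TILT-ANALYTICITY — a BOUND, uniform in `T`: `Z` is zero-free on the complex disc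
  `|c| < 2` with a holomorphic logarithm of volume order, `Z = exp(L³ q)`, `q(0) = 0`, `‖q‖ ≤ M`.
  Typed here, as the triage asked (r1-3 sharpen; r1-2 "crux ∧ (i): (i) is the whole new content"), in
  the currency its natural proof consumes: `stub_siteSummableLabelCumulants` = the Kotecký–Preiss SITE
  criterion `Σ_{B∋i} ‖κ_B(c)‖ e^{a|B|} ≤ a` for the joint cumulants `κ_B` of the LABEL FIELD
  `u_j(c) = e^{2c a_j} − 1`, uniformly in `T ≥ T₀` (and in `R, L, n ≤ 2L³, Ψ`, `|c| < 2`); the passage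
  "site criterion ⇒ holomorphic volume-order log" is the abstract, known `stub_koteckyPreissLog`
  (Dobrushin's inductive criterion is PROVED in the tree: `Literature.Probability.LatticeModels.
  polymerPartitionFunction_ne_zero_and_ratio_le`; polymers = nonempty label sets, activities = joint
  cumulants, incompatibility = intersection; moment–cumulant formula = the polymer representation).
* (ii) FIXED-ORDER DECAY — qualitative, rate-free, NOT uniform in the order: for each fixed `k` the
  `k`-th Taylor coefficient at `0` of the normalised logarithm `q = L⁻³ log Z` is eventually `≤ η`
  (`stub_fixedOrderCumulantDecay`, stated branch-free: for EVERY local holomorphic `q` with `q 0 = 0`,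
  `exp(L³ q) = Z` near `0` — they all have the same jet). `k = 1`: boundary layer; `k = 2`: the cell
  twin of the shared L² milestone FastObservableMeanErgodic (10952); `k ≥ 3`: Cesàro decay of k-point
  truncated time correlations per volume.
* TRANSFER (PROVED here, `taylorTailControl`): Cauchy's estimate on `|c| = 3/2` turns the bound (i)
  into the `T`-uniform majorant `M(2/3)^k` of the Taylor series on `|c| ≤ 1`; (ii) kills the head:
  `‖q‖ ≤ δ` on the closed unit disc, effective in `(M, δ) ↦ (K, η)` chosen BEFORE `T`.
The LD content of the crux beyond its L² sibling is exactly uniformity over the cumulant order `k`;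
complex analyticity in the tilt converts that uniformity into the bound (i).

## Composition (kernel-checked, sorry-free)
`CellForecastPressureDecay_of : stub_siteSummableLabelCumulants → stub_koteckyPreissLog →
stub_fixedOrderCumulantDecay → AntiMazurCoboundaries.CellForecastPressureDecay`
(D-0027 §3.3 shape: `def stub_x : Prop := type_of% Holds.stub_x`). Proved inside: `σ₀ := min (min σ₁ σ₃) (3/16)`,
`κ := min κ₁ κ₃`; `(K, η) := taylorTailControl (2a) δ`; the thresholds of (i) and of (ii) for `k < K`
are merged (`Frame.and`, `frame_finite`) into `T := max T₁ T₃`, `R₀`, `L₀ := max L₀' 1`; the cell law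
is a probability measure (landed `Negative/WithoutOrthogonality.isProbabilityMeasure_cellLaw`, σ ≤ 3/16,
L ≥ 1); window averages are measurable and `|aᵢ| ≤ κ` (`measurable_windowAvg`, `abs_windowAvg_le`);
KP gives `q'` with `exp q' = Z`, `‖q'‖ ≤ a n ≤ 2a L³`; `q := L⁻³ q'` has `‖q‖ ≤ 2a` on `|c| < 2` and,
by (ii), `‖q^{(k)}(0)‖ ≤ η` for `k < K`; `taylorTailControl` ⇒ `‖q(c)‖ ≤ δ` for real `|c| ≤ 1`;
`‖Z(c)‖ = exp(Re q') ≤ exp(δL³)`; and at real `c` the crux's `lintegral` IS `‖Z(c)‖`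
(`lintegral_exp_eq_norm_tiltZ`: `ofReal_integral_eq_lintegral_ofReal` + `integral_ofReal`).

## Disproof used (`Cruxes/CellForecastPressureDecay/Disproof.lean`, cdisprove cycle 1: NO KILL; landed
`Theorems/CellForecastPressureDecay/Negative/{WithoutOrthogonality,LoneParticle,PerParticle}.lean`, imported)
* `cellForecastPressureDecay_false_without_orthogonality` (g ≡ κ): honoured at `stub_fixedOrderCumulantDecay`,
  `k = 1` — for `g ≡ κ` the first coefficient is `2κ n/L³ ↛ 0`; both dynamical stubs CARRY the
  orthogonality hypothesis (k = 2 needs all of span(1,v,|v|²): conserved `v`, `|v|²` components are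
  Drude weights). `stub_siteSummableLabelCumulants` alone does NOT refute `g ≡ κ` (it holds there:
  `u_j` constant, `κ_B = 0` for `|B| ≥ 2`) — consistent: the witness kills (ii), not (i).
* `cellForecastPressureDecay_false_perParticle` (n = 1, `e^{δn}`): every bound here is per VOLUME
  (`‖q'‖ ≤ a·n ≤ 2aL³`, coefficients of `L⁻³ log Z`); for `n = 1`, `windowAverage_one` gives
  `Z(c) = ∫M e^{2cg}` at every `T`, entire and zero-free on `|c|<2` for `κ ≤ 1/8` ((i) ✓), and its
  normalised jet is `O(L⁻³)` ((ii) ✓ because `L₀` is chosen after `T`, exactly as in the crux).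
* § 7 near-miss (amplitude clause): the energy-shell mode is a common component `(c g″/n)·ξ`,
  `ξ = n(θ̂−1)² ~ (2/3)χ²₁`, of all `u_j`; its joint cumulants `(cg″/n)^k κ_k(ξ)`, `κ_k(ξ) = (4/3)^k (k−1)!/2`,
  contribute `n⁻¹ Σ_k (4|c|g″e^a/3)^k` to the site sum — geometric, convergent iff `|c| g″ < 3e^{-a}/4`:
  the `∃κ` floor is where `stub_siteSummableLabelCumulants` diverges (the card's real branch point
  `c* = 3/(8G₂)`, now with the KP margin `e^{-a}`), so `∃κ` is used AT stub 1, not by a side computation.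
* § 1 frame (`isProbabilityMeasure_cellLaw`) is used verbatim in the composition; § 5 `gW` is the test
  observable for the MD falsifier of stub 1 (line card).
No stub is an instance of a landed Negative lemma (stubs 1, 3 carry orthogonality, amplitude `∃κ` and
per-volume normalisation; stub 2 is abstract combinatorics/complex analysis).
-/

open MeasureTheory Set Metric Filter ProbabilityTheory Topology
open scoped ENNReal BigOperators
open Literature.Analysis.FluidPDE Literature.MathematicalPhysics.KineticTheory

namespace Summit.AtomisticToContinuum.HydrodynamicLimit.Cruxes.CellForecastPressureDecay.TiltAnalyticityTransfer

noncomputable section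

/-! ## Objects of the line (transparent abbreviations of the crux's own terms) -/

/-- Families of Euclidean hard-sphere flows in `ℝ³` with diameter `σ`, one for every particle number
(the crux's `Ψ`). -/
abbrev Flows (σ : ℝ) : Type := (k : ℕ) → HardSphereFlow (Euclidean.geometry (Fin 3)) σ k

/-- The canonical cell Gibbs law `P_{n,L}` of the crux, verbatim: `n` spheres of diameter `σ`,
positions in `[0,L]³` (hard core), standard Maxwellian velocities. -/
def cellLaw (σ : ℝ) (n : ℕ) (L : ℝ) (Φ : HardSphereFlow (Euclidean.geometry (Fin 3)) σ n) :
    Measure (Config n (Fin 3) V3) :=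
  particleLaw Φ (canonicalDensity (Euclidean.geometry (Fin 3)) σ n
    (fun p => Set.indicator {x : V3 | ∀ k, x k ∈ Set.Icc (0 : ℝ) L} (fun _ => (1 : ℝ)) p.1 *
      globalMaxwellian p.2))

/-- The window average `aᵢ(z) = T⁻¹ ∫₀ᵀ g(v^{fc}_i(t)) dt` of `g` along the `R`-local forecast of
particle `i` (the crux's summand, verbatim). -/
def windowAvg {σ : ℝ} {n : ℕ} (Ψ : Flows σ) (R T : ℝ) (g : V3 → ℝ) (z : Config n (Fin 3) V3)
    (i : Fin n) : ℝ :=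
  T⁻¹ * ∫ t in (0 : ℝ)..T, g (localClusterState Ψ R t z i).2

/-- The COMPLEX TILT partition function `Z(c) = ∫ exp(2c Σᵢ aᵢ) dP_{n,L}` (entire in `c`; at real
`c ∈ [-1,1]` its value is the crux's left-hand side, `lintegral_exp_eq_norm_tiltZ`). -/
def tiltZ {σ : ℝ} (n : ℕ) (Ψ : Flows σ) (R T L : ℝ) (g : V3 → ℝ) (c : ℂ) : ℂ :=
  ∫ z, Complex.exp (2 * c * ((∑ i : Fin n, windowAvg Ψ R T g z i : ℝ) : ℂ)) ∂(cellLaw σ n L (Ψ n))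

/-- The LABEL FIELD `u_j(c)(z) = exp(2c a_j(z)) − 1` (`|u_j| ≤ e^{4κ} − 1` on `|c| < 2`), whose
polymer (cluster) expansion in the label sets is the natural proof of tilt-analyticity. -/
def labelField {σ : ℝ} {n : ℕ} (Ψ : Flows σ) (R T : ℝ) (g : V3 → ℝ) (c : ℂ) (j : Fin n)
    (z : Config n (Fin 3) V3) : ℂ :=
  Complex.exp (2 * c * (windowAvg Ψ R T g z j : ℂ)) - 1

/-- The JOINT CUMULANT (Ursell function, truncated correlation) of the variables `(u_j)_{j ∈ B}` under
`P`: Möbius inversion on the partition lattice,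
`κ_B = Σ_{π ⊢ B} (−1)^{|π|−1} (|π|−1)! ∏_{b ∈ π} E[∏_{j∈b} u_j]`, so that
`E[∏_{j∈A} u_j] = Σ_{π ⊢ A} ∏_{b∈π} κ_b` for every finite `A`. -/
def jointCumulant {Ω : Type*} {ι : Type*} [MeasurableSpace Ω] [DecidableEq ι] (P : Measure Ω)
    (u : ι → Ω → ℂ) (B : Finset ι) : ℂ :=
  ∑ π : Finpartition B, (-1 : ℂ) ^ (π.parts.card - 1) *
    ((Nat.factorial (π.parts.card - 1) : ℕ) : ℂ) * ∏ b ∈ π.parts, ∫ ω, ∏ j ∈ b, u j ω ∂P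

/-- The quantifier FRAME shared by the crux and the dynamical stubs after `T`:
`∀ T ≥ T₀ ∃ R₀ ∀ R ≥ R₀ ∃ L₀ ∀ L ≥ L₀ ∀ n ≤ 2L³ ∀ Ψ, P T R L n Ψ`. -/
def Frame {σ : ℝ} (P : ℝ → ℝ → ℝ → (n : ℕ) → Flows σ → Prop) (T₀ : ℝ) : Prop :=
  ∀ T : ℝ, T₀ ≤ T → ∃ R₀ : ℝ, 0 < R₀ ∧ ∀ R : ℝ, R₀ ≤ R → ∃ L₀ : ℝ, 0 < L₀ ∧ ∀ L : ℝ, L₀ ≤ L →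
    ∀ n : ℕ, (n : ℝ) ≤ 2 * L ^ 3 → ∀ Ψ : Flows σ, P T R L n Ψ

/-! ## Registered stubs (`Holds.stub_*`, bodies `sorry`) -/

namespace Holds

/-- STUB 1 — SITE-SUMMABLE LABEL CUMULANTS, UNIFORMLY IN THE WINDOW (the HARDEST stub; the whole
new content of the line = card (i) in Kotecký–Preiss currency, as triage r1-3 asked). For `σ < σ₀`
there is an amplitude `κ` such that for every admissible `g` there are a KP weight `a > 0` and a
horizon `T₀` with: for `T ≥ T₀` (then `R ≥ R₀(T)`, `L ≥ L₀`, `n ≤ 2L³`, any `Ψ`), every complex tilt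
`|c| < 2` and every label `i`,
  `Σ_{B ∋ i} ‖κ_B(c)‖ · e^{a|B|} ≤ a`,
`κ_B(c)` the joint cumulant under `P_{n,L}` of the label field `(e^{2c a_j} − 1)_{j ∈ B}`.
Content: under `P_{n,L}` the labels are EXCHANGEABLE (positions integrated out), so the sum is
`Σ_k C(n−1,k−1) |κ_k| e^{ak}` and the stub asks the mean-field / size-of-chaos scaling
`|κ_k| ≲ (k−1)!·(Cκ)^k n^{1−k} × (no growth in T)`: `k` labels are correlated only through a collision
tree connecting them inside the window (probability `≍ k^{k−2}(T/(n t_mf))^{k−1}`), each label's window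
average being correlated with the tree for a time `O(t_mf)` out of `T` (factor `(t_mf/T)^k`), whence
heuristically `Σ_{B∋i,|B|=k} |κ_B| ≍ (C'κ)^k k^{k−2}/(k−1)! · (t_mf/T)` — geometric in `k` with DECAY in
`T`; the stub asks only BOUNDEDNESS. This is BGSS's cumulant hierarchy (BGSSAnnals2023: cumulant
generating functional analytic, order-`k` cumulants `O(μ_ε^{1−k})`, Lanford time, Boltzmann–Grad) at
FIXED σ and ALL kinetic times — the "uniform-in-time bound on resummed objects" of
`NoDensityExpansionNarrow` item 1 (neither blocked nor supported). Consistency: collisionless / σ → 0: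
`a_j = g(v_j)` i.i.d., `κ_B = 0` for `|B| ≥ 2`, singleton term `e^a(e^{4κ}−1) ≤ a` for `κ` small ✓;
`g ≡ κ` (Disproof §2): holds (constant labels) ✓ — orthogonality is NOT what this stub consumes;
energy-shell / hydrodynamic slow modes: common components of amplitude `κ/(#labels in the mode)`
give `n⁻¹Σ_k(4|c|g″e^a/3)^k`, convergent iff `κ < κ*(a)` — the `∃κ` clause is consumed HERE.
Why it might fail: a hidden persistent many-label correlation at fixed σ (ring/recollision
resummation failing at high order uniformly in T) = trajectory-space phase coexistence of the
equilibrium dilute gas at amplitude κ. Size XL (open). Leans on: BGSSAnnals2023, BGSSCPAM2023 Thm 1.1,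
BodineauEtAl2024 Thm 1.2–1.3, PulvirentiTsagkarogiannis2012 (T = 0 canonical cluster expansion),
Ruelle1969 Thm 4.2.3. -/
theorem stub_siteSummableLabelCumulants :
    ∃ σ₀ : ℝ, 0 < σ₀ ∧ ∀ σ : ℝ, 0 < σ → σ < σ₀ → ∃ κ : ℝ, 0 < κ ∧ ∀ g : V3 → ℝ, Continuous g →
      (∀ v, |g v| ≤ κ) →
      (∀ (c₀ c₂ : ℝ) (b : V3),
        ∫ v, g v * (c₀ + inner ℝ b v + c₂ * ‖v‖ ^ 2) ∂(stdGaussian V3) = 0) →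
      ∃ a : ℝ, 0 < a ∧ ∃ T₀ : ℝ, 0 < T₀ ∧ ∀ T : ℝ, T₀ ≤ T → ∃ R₀ : ℝ, 0 < R₀ ∧ ∀ R : ℝ, R₀ ≤ R →
        ∃ L₀ : ℝ, 0 < L₀ ∧ ∀ L : ℝ, L₀ ≤ L → ∀ n : ℕ, (n : ℝ) ≤ 2 * L ^ 3 →
          ∀ Ψ : (k : ℕ) → HardSphereFlow (Euclidean.geometry (Fin 3)) σ k,
            ∀ c : ℂ, ‖c‖ < 2 → ∀ i : Fin n,
              ∑ B ∈ (Finset.univ : Finset (Finset (Fin n))).filter (fun B => i ∈ B),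
                ‖jointCumulant (cellLaw σ n L (Ψ n)) (labelField Ψ R T g c) B‖ *
                  Real.exp (a * B.card) ≤ a := by
  sorry

/-- STUB 2 — KOTECKÝ–PREISS WITH A HOLOMORPHIC PARAMETER (abstract; known theorem, size L; the tree
PROVES Dobrushin's inductive criterion `Literature.Probability.LatticeModels.
polymerPartitionFunction_ne_zero_and_ratio_le` for hard-core polymer gases with complex activities).
For a probability space, finitely many bounded measurable real variables `w_j`, and the label field
`u_j(c) = e^{2c w_j} − 1`: IF on the tilt disc `|c| < ρ` the joint cumulants satisfy the site
criterion `Σ_{B∋i}‖κ_B(c)‖e^{a|B|} ≤ a`, THEN `E e^{2cΣ_j w_j} = E∏_j(1+u_j(c))` has a HOLOMORPHIC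
logarithm `q` on the disc with `q(0) = 0` and `‖q(c)‖ ≤ a·n`. Proof plan: (1) polymer representation
`E∏_{j}(1+u_j) = Σ_{A} E∏_{j∈A}u_j = Σ_A Σ_{π⊢A} ∏_{b∈π} κ_b = Ξ` (moment–cumulant formula = Möbius
inversion on `Finpartition`; `Ξ = polymerPartitionFunction` over nonempty label sets, incompatible iff
intersecting, activity `κ_B(c)`); (2) Dobrushin's condition with `μ_B = ‖κ_B‖e^{a|B|}`:
`∏_{B'∩B≠∅}(1+μ_{B'}) ≤ exp(Σ_{x∈B}Σ_{B'∋x}μ_{B'}) ≤ e^{a|B|}` by the site criterion, so the tree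
theorem gives `Ξ_Λ ≠ 0` and `‖Ξ_Λ/Ξ_{Λ∖B} − 1‖ ≤ μ_B/(1+μ_B) < 1` for all subfamilies `Λ`; (3) add the
polymers one at a time: `q(c) := Σ_j Log(Ξ_{Λ_j}(c)/Ξ_{Λ_{j−1}}(c))` (principal branch, arguments in
`Re > 0`) is holomorphic (each `κ_B` is entire in `c`: bounded `w_j`, probability `P`), `q(0) = 0`
(`u_j(0) = 0 ⇒ κ_B(0) = 0 ⇒ Ξ_Λ(0) = 1`), `exp q = Ξ`, `‖q‖ ≤ Σ_{B≠∅} log(1+μ_B) ≤ Σ_x Σ_{B∋x} μ_B ≤ a n`.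
Why plausible: it is Kotecký–Preiss 1986 / Dobrushin 1996 / Fernández–Procacci 2007 §2 verbatim for
the subset polymer gas; only (1) and the holomorphy bookkeeping are not yet in the tree.
Leans on: `polymerPartitionFunction_insert`, `polymerPartitionFunction_ne_zero_and_ratio_le`,
`norm_polymerPartitionFunction_sdiff_div_le_exp` (tree, PROVED); Mathlib `Finpartition`,
`Complex.log`, `DifferentiableOn.clog`, `hasDerivAt_integral_of_dominated_loc_of_deriv_le`. -/
theorem stub_koteckyPreissLog :
    ∀ (Ω : Type) [MeasurableSpace Ω] (P : Measure Ω) [IsProbabilityMeasure P] (n : ℕ)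
      (w : Fin n → Ω → ℝ) (A : ℝ), (∀ j, Measurable (w j)) → (∀ j ω, |w j ω| ≤ A) →
      ∀ (ρ a : ℝ), 0 < ρ → 0 < a →
      (∀ c : ℂ, ‖c‖ < ρ → ∀ i : Fin n,
        ∑ B ∈ (Finset.univ : Finset (Finset (Fin n))).filter (fun B => i ∈ B),
          ‖jointCumulant P (fun j ω => Complex.exp (2 * c * (w j ω : ℂ)) - 1) B‖ *
            Real.exp (a * B.card) ≤ a) →
      ∃ q : ℂ → ℂ, DifferentiableOn ℂ q (ball 0 ρ) ∧ q 0 = 0 ∧ ∀ c : ℂ, ‖c‖ < ρ →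
        Complex.exp (q c) = ∫ ω, Complex.exp (2 * c * ((∑ j, w j ω : ℝ) : ℂ)) ∂P ∧
          ‖q c‖ ≤ a * n := by
  sorry

/-- STUB 3 — FIXED-ORDER CUMULANT DECAY (card (ii); qualitative, rate-free, one order at a time; size
L per order, OPEN at k = 2 = the cell twin of the shared L² milestone FastObservableMeanErgodic 10952).
For `σ < σ₀`, an amplitude `κ`, every admissible `g`, every ORDER `k` and tolerance `η`: eventually in
`T` (then `R ≥ R₀(T)`, `L ≥ L₀`, `n ≤ 2L³`, any `Ψ`), every local normalised logarithm `q` of the tilt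
partition function (`q` holomorphic on some `|c| < r`, `q(0) = 0`, `exp(L³ q) = Z`; all such `q`
have the same jet at `0`, and one exists for small `r` since `Z(0) = 1`) has `‖q^{(k)}(0)‖ ≤ η`;
i.e. the `k`-th cumulant of `2Σᵢaᵢ` per volume (times `1`, over `k!` it is the Taylor coefficient)
tends to `0` as `T → ∞`, uniformly in the cell. `k = 0`: `q(0) = 0` ✓. `k = 1`: `2E[Σaᵢ]/L³`:
bulk particles with `R ≫ T` have Maxwellian forecast velocity law at each time and `∫g dγ = 0`
(orthogonality to `1` — Disproof §2's witness `g ≡ κ` fails exactly here), boundary/escaping layer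
`O(T L²)/L³ → 0` (L₀ after T; refuter note (b): do NOT claim `E g(forecast) = 0` pointwise near ∂Q_L).
`k = 2`: `4Var(Σaᵢ)/L³ → 0` — zero Drude weight of `g` per volume (needs `g ⊥ v, |v|²` too: conserved
components do not decay), the anti-Mazur statement itself at L² (MazurBoundBallisticNarrow (4)–(5):
`L → ∞` before `T → ∞` ✓ as in the crux); engines: fixed-ε BGSS L²-duality (BodineauEtAl2024 Thm 1.2
is its ε → 0 shadow), the Enskog–Poisson compensator sum rule of the sibling line, Mourre/LAP of
MourreKoopmanCharges. `k ≥ 3`: Cesàro decay of `k`-point truncated time correlations of the one-body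
`g`-field per volume, by the same finite-order bookkeeping — WITHOUT uniformity in `k` (that is stub 1's
job). Why it might fail: a bulk LD-Drude weight (hidden quasi-local conserved charge overlapping `g`)
kills `k = 2` — and the crux with it (BoltzmannHypothesisBarrierNarrow caveat (b)); collisionless
cells are harmless (`p_k ≤ ρ(2κ)^k`, `ρ ≲ 1/(σ²T)`). Leans on: BodineauEtAl2024 Thm 1.2/1.3,
BGSSCPAM2023 Thm 1.1, VanbeijerenEtAl1980, Spohn1991 Thm 7.3; tree `InfluenceLocality` (13916) /
`LocalForecastCorrector` API for `k = 1`. -/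
theorem stub_fixedOrderCumulantDecay :
    ∃ σ₀ : ℝ, 0 < σ₀ ∧ ∀ σ : ℝ, 0 < σ → σ < σ₀ → ∃ κ : ℝ, 0 < κ ∧ ∀ g : V3 → ℝ, Continuous g →
      (∀ v, |g v| ≤ κ) →
      (∀ (c₀ c₂ : ℝ) (b : V3),
        ∫ v, g v * (c₀ + inner ℝ b v + c₂ * ‖v‖ ^ 2) ∂(stdGaussian V3) = 0) →
      ∀ k : ℕ, ∀ η : ℝ, 0 < η → ∃ T₀ : ℝ, 0 < T₀ ∧ ∀ T : ℝ, T₀ ≤ T → ∃ R₀ : ℝ, 0 < R₀ ∧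
        ∀ R : ℝ, R₀ ≤ R → ∃ L₀ : ℝ, 0 < L₀ ∧ ∀ L : ℝ, L₀ ≤ L → ∀ n : ℕ, (n : ℝ) ≤ 2 * L ^ 3 →
          ∀ Ψ : (k : ℕ) → HardSphereFlow (Euclidean.geometry (Fin 3)) σ k,
            ∀ r : ℝ, 0 < r → ∀ q : ℂ → ℂ, DifferentiableOn ℂ q (ball 0 r) → q 0 = 0 →
              (∀ c : ℂ, ‖c‖ < r → Complex.exp ((L : ℂ) ^ 3 * q c) = tiltZ n Ψ R T L g c) →
              ‖iteratedDeriv k q 0‖ ≤ η := by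
  sorry

end Holds

/-! ## Stub statements by name (D-0027 §3.3: the hypotheses of `_of` are these `Prop`s) -/

/-- Statement of registered stub 1 (`Holds.stub_siteSummableLabelCumulants`), by name. -/
def stub_siteSummableLabelCumulants : Prop := type_of% Holds.stub_siteSummableLabelCumulants
/-- Statement of registered stub 2 (`Holds.stub_koteckyPreissLog`), by name. -/
def stub_koteckyPreissLog : Prop := type_of% Holds.stub_koteckyPreissLog
/-- Statement of registered stub 3 (`Holds.stub_fixedOrderCumulantDecay`), by name. -/
def stub_fixedOrderCumulantDecay : Prop := type_of% Holds.stub_fixedOrderCumulantDecay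

/-! ## Proved: the transfer lemma (effective Cauchy-estimate form of the card's `TaylorwiseNullTransfer`) -/

/-- **Taylor tail control** (the card's first lemma, effective form; PROVED). For every bound `M` and
tolerance `ε > 0` there are an order `K` and a threshold `η > 0` such that every `F` holomorphic on
the disc `|c| < 2` with `‖F‖ ≤ M` there and `‖F^{(k)}(0)‖ ≤ η` for `k < K` satisfies `‖F‖ ≤ ε` on
`|c| ≤ 1`. Proof: Taylor expansion at `0` (`Complex.hasSum_taylorSeries_on_ball`), Cauchy's estimate on
the circle `|c| = 3/2` (`Complex.norm_iteratedDeriv_le_of_forall_mem_sphere_norm_le`) bounds the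
`k`-th term by `M(2/3)^k` on the unit disc, the tail from `K` by `3M(2/3)^K ≤ ε/2`, the head by
`K·η ≤ ε/2`. -/
theorem taylorTailControl (M ε : ℝ) (hε : 0 < ε) :
    ∃ K : ℕ, ∃ η : ℝ, 0 < η ∧ ∀ F : ℂ → ℂ, DifferentiableOn ℂ F (ball 0 2) →
      (∀ c : ℂ, ‖c‖ < 2 → ‖F c‖ ≤ M) → (∀ k : ℕ, k < K → ‖iteratedDeriv k F 0‖ ≤ η) →
      ∀ c : ℂ, ‖c‖ ≤ 1 → ‖F c‖ ≤ ε := by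
  set M' : ℝ := max M 0 with hM'
  have hM'0 : 0 ≤ M' := le_max_right _ _
  obtain ⟨K, hK⟩ : ∃ K : ℕ, (2 / 3 : ℝ) ^ K < ε / 2 / (3 * M' + 1) :=
    exists_pow_lt_of_lt_one (by positivity) (by norm_num)
  have hK' : 3 * M' * (2 / 3 : ℝ) ^ K ≤ ε / 2 := by
    have h31 : 0 < 3 * M' + 1 := by positivity
    calc 3 * M' * (2 / 3 : ℝ) ^ K ≤ (3 * M' + 1) * (2 / 3 : ℝ) ^ K := by gcongr; linarith
      _ ≤ (3 * M' + 1) * (ε / 2 / (3 * M' + 1)) := by gcongr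
      _ = ε / 2 := by field_simp
  refine ⟨K, ε / (2 * (K + 1)), by positivity, fun F hF hM hD c hc => ?_⟩
  have hc1 : ‖c‖ ≤ 1 := hc
  have hc2 : c ∈ ball (0 : ℂ) 2 := by rw [mem_ball_zero_iff]; linarith
  -- Taylor series of `F` at `0`, evaluated at `c`
  have hsum : HasSum (fun m : ℕ => ((m.factorial : ℂ))⁻¹ • (c - 0) ^ m • iteratedDeriv m F 0)
      (F c) := Complex.hasSum_taylorSeries_on_ball hF hc2
  -- Cauchy's estimates on the circle of radius 3/2
  have hR : DiffContOnCl ℂ F (ball (0 : ℂ) (3 / 2)) :=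
    hF.diffContOnCl_ball (closedBall_subset_ball (by norm_num))
  have hsph : ∀ z ∈ sphere (0 : ℂ) (3 / 2), ‖F z‖ ≤ M' := fun z hz =>
    (hM z (by rw [mem_sphere_zero_iff_norm.1 hz]; norm_num)).trans (le_max_left _ _)
  have hfacpos : ∀ m : ℕ, (0 : ℝ) < m.factorial := fun m => by exact_mod_cast m.factorial_pos
  have hcauchy : ∀ m : ℕ, ‖iteratedDeriv m F 0‖ ≤ m.factorial * (M' * (2 / 3 : ℝ) ^ m) := by
    intro m
    have h := Complex.norm_iteratedDeriv_le_of_forall_mem_sphere_norm_le m (by norm_num) hR hsph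
    have e : (m.factorial : ℝ) * M' / (3 / 2) ^ m = m.factorial * (M' * (2 / 3) ^ m) := by
      rw [mul_div_assoc, div_eq_mul_inv, ← inv_pow]
      norm_num
    rw [e] at h
    exact h
  -- the terms of the series
  have hnormA : ∀ m : ℕ, ‖((m.factorial : ℂ))⁻¹ • (c - 0) ^ m • iteratedDeriv m F 0‖ =
      (m.factorial : ℝ)⁻¹ * ‖c‖ ^ m * ‖iteratedDeriv m F 0‖ := by
    intro m
    rw [norm_smul, norm_smul, norm_inv, norm_pow, sub_zero, Complex.norm_natCast, mul_assoc]
  have hcm : ∀ m : ℕ, ‖c‖ ^ m ≤ 1 := fun m => pow_le_one₀ (norm_nonneg _) hc1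
  have hgeom : ∀ m : ℕ, ‖((m.factorial : ℂ))⁻¹ • (c - 0) ^ m • iteratedDeriv m F 0‖ ≤
      M' * (2 / 3 : ℝ) ^ m := by
    intro m
    rw [hnormA]
    have h1 : (m.factorial : ℝ)⁻¹ * ‖c‖ ^ m ≤ (m.factorial : ℝ)⁻¹ :=
      mul_le_of_le_one_right (inv_nonneg.2 (hfacpos m).le) (hcm m)
    calc (m.factorial : ℝ)⁻¹ * ‖c‖ ^ m * ‖iteratedDeriv m F 0‖
        ≤ (m.factorial : ℝ)⁻¹ * (m.factorial * (M' * (2 / 3 : ℝ) ^ m)) :=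
          mul_le_mul h1 (hcauchy m) (norm_nonneg _) (inv_nonneg.2 (hfacpos m).le)
      _ = M' * (2 / 3 : ℝ) ^ m := by rw [inv_mul_cancel_left₀ (hfacpos m).ne']
  have hhead : ∀ m : ℕ, m < K → ‖((m.factorial : ℂ))⁻¹ • (c - 0) ^ m • iteratedDeriv m F 0‖ ≤
      ε / (2 * (K + 1)) := by
    intro m hm
    rw [hnormA]
    have h1 : (m.factorial : ℝ)⁻¹ * ‖c‖ ^ m ≤ 1 := by
      calc (m.factorial : ℝ)⁻¹ * ‖c‖ ^ m ≤ (m.factorial : ℝ)⁻¹ :=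
            mul_le_of_le_one_right (inv_nonneg.2 (hfacpos m).le) (hcm m)
        _ ≤ 1 := inv_le_one_of_one_le₀ (by exact_mod_cast Nat.succ_le_of_lt m.factorial_pos)
    calc (m.factorial : ℝ)⁻¹ * ‖c‖ ^ m * ‖iteratedDeriv m F 0‖ ≤ 1 * (ε / (2 * (K + 1))) :=
          mul_le_mul h1 (hD m hm) (norm_nonneg _) zero_le_one
      _ = ε / (2 * (K + 1)) := one_mul _
  -- split the series at order `K`
  have htail := (hasSum_nat_add_iff' K).2 hsum
  have hgeomS : HasSum (fun m : ℕ => M' * (2 / 3 : ℝ) ^ K * (2 / 3 : ℝ) ^ m)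
      (M' * (2 / 3 : ℝ) ^ K * (1 - 2 / 3)⁻¹) :=
    (hasSum_geometric_of_lt_one (by norm_num) (by norm_num)).mul_left _
  have htailb : ‖F c - ∑ i ∈ Finset.range K,
      ((i.factorial : ℂ))⁻¹ • (c - 0) ^ i • iteratedDeriv i F 0‖ ≤
        M' * (2 / 3 : ℝ) ^ K * (1 - 2 / 3)⁻¹ :=
    htail.norm_le_of_bounded hgeomS fun m => by
      calc ‖(((m + K).factorial : ℂ))⁻¹ • (c - 0) ^ (m + K) • iteratedDeriv (m + K) F 0‖
          ≤ M' * (2 / 3 : ℝ) ^ (m + K) := hgeom _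
        _ = M' * (2 / 3 : ℝ) ^ K * (2 / 3 : ℝ) ^ m := by rw [pow_add]; ring
  have hheadb : ‖∑ i ∈ Finset.range K, ((i.factorial : ℂ))⁻¹ • (c - 0) ^ i • iteratedDeriv i F 0‖ ≤
      K * (ε / (2 * (K + 1))) := by
    calc ‖∑ i ∈ Finset.range K, ((i.factorial : ℂ))⁻¹ • (c - 0) ^ i • iteratedDeriv i F 0‖
        ≤ ∑ i ∈ Finset.range K, ‖((i.factorial : ℂ))⁻¹ • (c - 0) ^ i • iteratedDeriv i F 0‖ :=
          norm_sum_le _ _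
      _ ≤ ∑ i ∈ Finset.range K, ε / (2 * (K + 1)) :=
          Finset.sum_le_sum fun i hi => hhead i (Finset.mem_range.1 hi)
      _ = K * (ε / (2 * (K + 1))) := by simp
  have hK1 : (0 : ℝ) < K + 1 := by positivity
  calc ‖F c‖ = ‖(F c - ∑ i ∈ Finset.range K,
          ((i.factorial : ℂ))⁻¹ • (c - 0) ^ i • iteratedDeriv i F 0) +
        ∑ i ∈ Finset.range K, ((i.factorial : ℂ))⁻¹ • (c - 0) ^ i • iteratedDeriv i F 0‖ := by
          rw [sub_add_cancel]
    _ ≤ ‖F c - ∑ i ∈ Finset.range K,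
          ((i.factorial : ℂ))⁻¹ • (c - 0) ^ i • iteratedDeriv i F 0‖ +
        ‖∑ i ∈ Finset.range K, ((i.factorial : ℂ))⁻¹ • (c - 0) ^ i • iteratedDeriv i F 0‖ :=
          norm_add_le _ _
    _ ≤ M' * (2 / 3 : ℝ) ^ K * (1 - 2 / 3)⁻¹ + K * (ε / (2 * (K + 1))) := add_le_add htailb hheadb
    _ ≤ ε / 2 + ε / 2 := by
        apply add_le_add
        · have e : M' * (2 / 3 : ℝ) ^ K * (1 - 2 / 3)⁻¹ = 3 * M' * (2 / 3 : ℝ) ^ K := by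
            norm_num; ring
          rw [e]
          exact hK'
        · calc (K : ℝ) * (ε / (2 * (K + 1))) = ε / 2 * (K / (K + 1)) := by
                field_simp
            _ ≤ ε / 2 * 1 := by
                gcongr
                exact (div_le_one hK1).2 (by linarith)
            _ = ε / 2 := mul_one _
    _ = ε := by ring

/-! ## Proved: bookkeeping used by the composition -/

/-- Conjunction of two frames (thresholds merged by `max`). -/
theorem Frame.and {σ : ℝ} {P Q : ℝ → ℝ → ℝ → (n : ℕ) → Flows σ → Prop} {T₁ T₂ : ℝ}
    (h₁ : Frame P T₁) (h₂ : Frame Q T₂) :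
    Frame (fun T R L n Ψ => P T R L n Ψ ∧ Q T R L n Ψ) (max T₁ T₂) := by
  intro T hT
  obtain ⟨R₁, hR₁, h₁⟩ := h₁ T (le_of_max_le_left hT)
  obtain ⟨R₂, hR₂, h₂⟩ := h₂ T (le_of_max_le_right hT)
  refine ⟨max R₁ R₂, lt_max_of_lt_left hR₁, fun R hR => ?_⟩
  obtain ⟨L₁, hL₁, h₁⟩ := h₁ R (le_of_max_le_left hR)
  obtain ⟨L₂, hL₂, h₂⟩ := h₂ R (le_of_max_le_right hR)
  exact ⟨max L₁ L₂, lt_max_of_lt_left hL₁, fun L hL n hn Ψ =>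
    ⟨h₁ L (le_of_max_le_left hL) n hn Ψ, h₂ L (le_of_max_le_right hL) n hn Ψ⟩⟩

/-- Monotonicity of frames in the predicate. -/
theorem Frame.mono {σ : ℝ} {P Q : ℝ → ℝ → ℝ → (n : ℕ) → Flows σ → Prop} {T₀ : ℝ}
    (h : Frame P T₀) (hPQ : ∀ T R L n Ψ, P T R L n Ψ → Q T R L n Ψ) : Frame Q T₀ := by
  intro T hT
  obtain ⟨R₀, hR₀, h⟩ := h T hT
  refine ⟨R₀, hR₀, fun R hR => ?_⟩
  obtain ⟨L₀, hL₀, h⟩ := h R hR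
  exact ⟨L₀, hL₀, fun L hL n hn Ψ => hPQ _ _ _ _ _ (h L hL n hn Ψ)⟩

/-- Finitely many frames hold simultaneously, eventually. -/
theorem frame_finite {σ : ℝ} {P : ℕ → ℝ → ℝ → ℝ → (n : ℕ) → Flows σ → Prop}
    (h : ∀ k : ℕ, ∃ T₀ : ℝ, 0 < T₀ ∧ Frame (P k) T₀) :
    ∀ K : ℕ, ∃ T₀ : ℝ, 0 < T₀ ∧ Frame (fun T R L n Ψ => ∀ k : ℕ, k < K → P k T R L n Ψ) T₀
  | 0 => ⟨1, one_pos, fun T _ => ⟨1, one_pos, fun R _ => ⟨1, one_pos,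
      fun L _ n _ Ψ k hk => absurd hk (Nat.not_lt_zero k)⟩⟩⟩
  | K + 1 => by
    obtain ⟨T₀, hT₀, hK⟩ := frame_finite h K
    obtain ⟨T₁, hT₁, h₁⟩ := h K
    refine ⟨max T₀ T₁, lt_max_of_lt_left hT₀, (hK.and h₁).mono ?_⟩
    rintro T R L n Ψ ⟨hA, hB⟩ k hk
    rcases (Nat.lt_succ_iff.1 hk).lt_or_eq with hk' | rfl
    · exact hA k hk'
    · exact hB

/-- **Measurability of the window average** in the configuration (joint measurability of the local
cluster state, `measurable_localClusterState`, and of parametric Bochner integrals). -/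
theorem measurable_windowAvg {σ : ℝ} {n : ℕ} (Ψ : Flows σ) (R T : ℝ) {g : V3 → ℝ}
    (hg : Measurable g) (i : Fin n) :
    Measurable fun z : Config n (Fin 3) V3 => windowAvg Ψ R T g z i := by
  have hG : ∀ x : V3, Continuous ((Euclidean.geometry (Fin 3)).translate x) :=
    fun x => (continuous_const.add continuous_id : Continuous fun v : V3 => x + v)
  have hI : Measurable (Function.uncurry fun (t : ℝ) (z : Config n (Fin 3) V3) =>
      g (localClusterState Ψ R t z i).2) :=
    hg.comp (measurable_localClusterState Ψ hG Euclidean.measurable_geometry_sepVec R i).snd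
  have h : ∀ μ : Measure ℝ, SFinite μ → Measurable fun z : Config n (Fin 3) V3 =>
      ∫ t, g (localClusterState Ψ R t z i).2 ∂μ := fun μ _ =>
    (hI.stronglyMeasurable.integral_prod_left (μ := μ)).measurable
  simp only [windowAvg, intervalIntegral]
  exact ((h _ inferInstance).sub (h _ inferInstance)).const_mul _

/-- `|aᵢ| ≤ κ` when `|g| ≤ κ` and `T > 0` (the interval integral is bounded by `κ T`, junk `0`
included). -/
theorem abs_windowAvg_le {σ : ℝ} {n : ℕ} (Ψ : Flows σ) {R T : ℝ} (hT : 0 < T) {g : V3 → ℝ}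
    {κ : ℝ} (hgb : ∀ v, |g v| ≤ κ) (z : Config n (Fin 3) V3) (i : Fin n) :
    |windowAvg Ψ R T g z i| ≤ κ := by
  have h := intervalIntegral.norm_integral_le_of_norm_le_const (a := (0 : ℝ)) (b := T)
    (f := fun t => g (localClusterState Ψ R t z i).2) (C := κ) (fun t _ => by
      rw [Real.norm_eq_abs]; exact hgb _)
  rw [sub_zero, abs_of_pos hT, Real.norm_eq_abs] at h
  rw [windowAvg, abs_mul, abs_inv, abs_of_pos hT]
  calc T⁻¹ * |∫ t in (0 : ℝ)..T, g (localClusterState Ψ R t z i).2| ≤ T⁻¹ * (κ * T) :=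
        mul_le_mul_of_nonneg_left h (inv_nonneg.2 hT.le)
    _ = κ := by field_simp

/-- **At real tilt the crux functional is `‖Z(c)‖`**: for `|g| ≤ κ`, `T > 0` and a finite cell law,
`∫⁻ e^{2cΣaᵢ} dP = ofReal ‖tiltZ c‖` (bounded measurable integrand; `integral_ofReal`). -/
theorem lintegral_exp_eq_norm_tiltZ {σ : ℝ} {n : ℕ} (Ψ : Flows σ) {R T : ℝ} (L : ℝ) (hT : 0 < T)
    {g : V3 → ℝ} {κ : ℝ} (hg : Measurable g) (hgb : ∀ v, |g v| ≤ κ)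
    [IsFiniteMeasure (cellLaw σ n L (Ψ n))] (c : ℝ) :
    ∫⁻ z, ENNReal.ofReal (Real.exp (2 * c * ∑ i : Fin n, windowAvg Ψ R T g z i))
        ∂(cellLaw σ n L (Ψ n)) = ENNReal.ofReal ‖tiltZ n Ψ R T L g c‖ := by
  have hSm : Measurable fun z : Config n (Fin 3) V3 => ∑ i : Fin n, windowAvg Ψ R T g z i :=
    Finset.measurable_sum _ fun i _ => measurable_windowAvg Ψ R T hg i
  have hfm : Measurable fun z : Config n (Fin 3) V3 =>
      Real.exp (2 * c * ∑ i : Fin n, windowAvg Ψ R T g z i) := (hSm.const_mul _).exp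
  have hbound : ∀ z : Config n (Fin 3) V3,
      |2 * c * ∑ i : Fin n, windowAvg Ψ R T g z i| ≤ 2 * |c| * (n * κ) := by
    intro z
    rw [abs_mul, abs_mul, abs_two]
    refine mul_le_mul_of_nonneg_left ?_ (by positivity)
    calc |∑ i : Fin n, windowAvg Ψ R T g z i| ≤ ∑ i : Fin n, |windowAvg Ψ R T g z i| :=
          Finset.abs_sum_le_sum_abs _ _
      _ ≤ ∑ _i : Fin n, κ := Finset.sum_le_sum fun i _ => abs_windowAvg_le Ψ hT hgb z i
      _ = n * κ := by simp
  have hfi : Integrable (fun z : Config n (Fin 3) V3 =>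
      Real.exp (2 * c * ∑ i : Fin n, windowAvg Ψ R T g z i)) (cellLaw σ n L (Ψ n)) := by
    refine (integrable_const (Real.exp (2 * |c| * (n * κ)))).mono' hfm.aestronglyMeasurable
      (Eventually.of_forall fun z => ?_)
    rw [Real.norm_eq_abs, abs_of_pos (Real.exp_pos _)]
    exact Real.exp_le_exp.2 ((le_abs_self _).trans (hbound z))
  have h1 := (ofReal_integral_eq_lintegral_ofReal hfi
    (Eventually.of_forall fun z => (Real.exp_pos _).le)).symm
  have h2 : tiltZ n Ψ R T L g c = ((∫ z, Real.exp (2 * c * ∑ i : Fin n, windowAvg Ψ R T g z i)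
      ∂(cellLaw σ n L (Ψ n)) : ℝ) : ℂ) := by
    rw [← integral_complex_ofReal]
    simp only [tiltZ]
    congr 1
    funext z
    rw [Complex.ofReal_exp]
    push_cast
    ring_nf
  have h3 : ‖tiltZ n Ψ R T L g c‖ =
      ∫ z, Real.exp (2 * c * ∑ i : Fin n, windowAvg Ψ R T g z i) ∂(cellLaw σ n L (Ψ n)) := by
    rw [h2, Complex.norm_real, Real.norm_eq_abs,
      abs_of_nonneg (integral_nonneg fun z => (Real.exp_pos _).le)]
  rw [h3]
  exact h1

/-! ## Composition (sorry-free): the three stubs ⟹ the crux BY NAME -/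

/-- **The skeleton theorem.** `σ₀ := min (min σ₁ σ₃) (3/16)`, `κ := min κ₁ κ₃`; given `g, δ`:
`(K, η) := taylorTailControl (2a) δ` with `a` the KP weight of stub 1; `T := max T₁ T₃` merges the
horizon of stub 1 with those of stub 3 for the orders `k < K` (`frame_finite`), then `R₀`, then
`L₀ := max L₀' 1`. At `(T, R, L, n, Ψ)`: the cell law is a probability measure (landed Negative §1),
stub 2 (fed stub 1's site criterion, measurability and `|aᵢ| ≤ κ`) gives the holomorphic log `q'`,
`‖q'‖ ≤ a n ≤ 2aL³`; `q := L⁻³q'` has `‖q‖ ≤ 2a` on `|c| < 2`, `q 0 = 0`, `exp(L³q) = Z`, hence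
(stub 3) `‖q^{(k)}(0)‖ ≤ η` for `k < K`, hence (`taylorTailControl`) `‖q c‖ ≤ δ` for `|c| ≤ 1`; so
`‖Z(c)‖ ≤ e^{δL³}`, and at real `c` the crux's left side is `‖Z(c)‖`. -/
theorem CellForecastPressureDecay_of
    (h₁ : stub_siteSummableLabelCumulants) (h₂ : stub_koteckyPreissLog)
    (h₃ : stub_fixedOrderCumulantDecay) :
    Summit.AtomisticToContinuum.HydrodynamicLimit.Theses.AntiMazurCoboundaries.CellForecastPressureDecay := by
  have H1 := (h₁ : type_of% Holds.stub_siteSummableLabelCumulants)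
  have H2 := (h₂ : type_of% Holds.stub_koteckyPreissLog)
  have H3 := (h₃ : type_of% Holds.stub_fixedOrderCumulantDecay)
  obtain ⟨σ₁, hσ₁, H1⟩ := H1
  obtain ⟨σ₃, hσ₃, H3⟩ := H3
  refine ⟨min (min σ₁ σ₃) (3 / 16), lt_min (lt_min hσ₁ hσ₃) (by norm_num), fun σ hσ hσlt => ?_⟩
  have hσ1 : σ < σ₁ := hσlt.trans_le ((min_le_left _ _).trans (min_le_left _ _))
  have hσ3 : σ < σ₃ := hσlt.trans_le ((min_le_left _ _).trans (min_le_right _ _))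
  have hσ' : σ ≤ 3 / 16 := (hσlt.trans_le (min_le_right _ _)).le
  obtain ⟨κ₁, hκ₁, H1⟩ := H1 σ hσ hσ1
  obtain ⟨κ₃, hκ₃, H3⟩ := H3 σ hσ hσ3
  refine ⟨min κ₁ κ₃, lt_min hκ₁ hκ₃, fun g hg hgb horth δ hδ => ?_⟩
  have hgb1 : ∀ v, |g v| ≤ κ₁ := fun v => (hgb v).trans (min_le_left _ _)
  have hgb3 : ∀ v, |g v| ≤ κ₃ := fun v => (hgb v).trans (min_le_right _ _)
  obtain ⟨a, ha, T₁, hT₁, H1⟩ := H1 g hg hgb1 horth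
  have H3g := H3 g hg hgb3 horth
  -- the constants of the transfer, for the bound `2a` and the tolerance `δ`
  obtain ⟨K, η, hη, HT⟩ := taylorTailControl (2 * a) δ hδ
  -- the two frames
  have hS : Frame (fun T R L n Ψ => ∀ c : ℂ, ‖c‖ < 2 → ∀ i : Fin n,
      ∑ B ∈ (Finset.univ : Finset (Finset (Fin n))).filter (fun B => i ∈ B),
        ‖jointCumulant (cellLaw σ n L (Ψ n)) (labelField Ψ R T g c) B‖ *
          Real.exp (a * B.card) ≤ a) T₁ := H1
  have hF : ∀ k : ℕ, ∃ T₀ : ℝ, 0 < T₀ ∧ Frame (fun T R L n Ψ => ∀ r : ℝ, 0 < r → ∀ q : ℂ → ℂ,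
      DifferentiableOn ℂ q (ball 0 r) → q 0 = 0 →
      (∀ c : ℂ, ‖c‖ < r → Complex.exp ((L : ℂ) ^ 3 * q c) = tiltZ n Ψ R T L g c) →
      ‖iteratedDeriv k q 0‖ ≤ η) T₀ := fun k => H3g k η hη
  obtain ⟨T₃, hT₃, hF⟩ := frame_finite hF K
  have hSF := hS.and hF
  refine ⟨max T₁ T₃, lt_max_of_lt_left hT₁, ?_⟩
  have hTpos : 0 < max T₁ T₃ := lt_max_of_lt_left hT₁
  obtain ⟨R₀, hR₀, hSF⟩ := hSF (max T₁ T₃) le_rfl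
  refine ⟨R₀, hR₀, fun R hR => ?_⟩
  obtain ⟨L₀, hL₀, hSF⟩ := hSF R hR
  refine ⟨max L₀ 1, lt_max_of_lt_left hL₀, fun L hL n hn Ψ c hc => ?_⟩
  have hL₀L : L₀ ≤ L := le_of_max_le_left hL
  have hL1 : 1 ≤ L := le_of_max_le_right hL
  have hLpos : 0 < L := one_pos.trans_le hL1
  obtain ⟨hSite, hDer⟩ := hSF L hL₀L n hn Ψ
  -- the cell law is a probability measure (landed Negative lemma, § 1 of the Disproof)
  haveI hP : IsProbabilityMeasure (cellLaw σ n L (Ψ n)) :=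
    Theorems.CellForecastPressureDecay.isProbabilityMeasure_cellLaw hσ' hL1 hn (Ψ n)
  -- stub 2 fed with stub 1: the holomorphic volume-order logarithm
  have hmeas : ∀ j : Fin n, Measurable fun z : Config n (Fin 3) V3 =>
      windowAvg Ψ R (max T₁ T₃) g z j := fun j => measurable_windowAvg Ψ R _ hg.measurable j
  have hbdd : ∀ (j : Fin n) (z : Config n (Fin 3) V3), |windowAvg Ψ R (max T₁ T₃) g z j| ≤ min κ₁ κ₃ :=
    fun j z => abs_windowAvg_le Ψ hTpos hgb z j
  obtain ⟨q', hq'd, hq'0, hq'⟩ := H2 (Config n (Fin 3) V3) (cellLaw σ n L (Ψ n)) n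
    (fun j z => windowAvg Ψ R (max T₁ T₃) g z j) (min κ₁ κ₃) hmeas hbdd 2 a two_pos ha hSite
  -- normalisation `q := L⁻³ q'`
  have hL3 : ((L : ℂ) ^ 3) ≠ 0 := pow_ne_zero _ (Complex.ofReal_ne_zero.2 hLpos.ne')
  have hqd : DifferentiableOn ℂ (fun c => ((L : ℂ) ^ 3)⁻¹ * q' c) (ball 0 2) :=
    (differentiableOn_const _).mul hq'd
  have hq0 : (fun c => ((L : ℂ) ^ 3)⁻¹ * q' c) 0 = 0 := by simp [hq'0]
  have hqexp : ∀ c : ℂ, ‖c‖ < 2 →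
      Complex.exp ((L : ℂ) ^ 3 * (fun c => ((L : ℂ) ^ 3)⁻¹ * q' c) c) = tiltZ n Ψ R (max T₁ T₃) L g c := by
    intro c hc
    have e : (L : ℂ) ^ 3 * (fun c => ((L : ℂ) ^ 3)⁻¹ * q' c) c = q' c := mul_inv_cancel_left₀ hL3 _
    rw [e]
    exact (hq' c hc).1
  have hqM : ∀ c : ℂ, ‖c‖ < 2 → ‖(fun c => ((L : ℂ) ^ 3)⁻¹ * q' c) c‖ ≤ 2 * a := by
    intro c hc
    have h1 : ‖q' c‖ ≤ a * n := (hq' c hc).2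
    have hL3pos : 0 < L ^ 3 := pow_pos hLpos 3
    show ‖((L : ℂ) ^ 3)⁻¹ * q' c‖ ≤ 2 * a
    rw [norm_mul, norm_inv, norm_pow, Complex.norm_real, Real.norm_eq_abs, abs_of_pos hLpos,
      inv_mul_le_iff₀ hL3pos]
    calc ‖q' c‖ ≤ a * n := h1
      _ ≤ a * (2 * L ^ 3) := by gcongr
      _ = L ^ 3 * (2 * a) := by ring
  -- stub 3: the first `K` Taylor coefficients are small
  have hqD : ∀ k : ℕ, k < K → ‖iteratedDeriv k (fun c => ((L : ℂ) ^ 3)⁻¹ * q' c) 0‖ ≤ η :=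
    fun k hk => hDer k hk 2 two_pos _ hqd hq0 hqexp
  -- the transfer: `‖q(c)‖ ≤ δ` at the real tilt `c`
  have hcC : ‖(c : ℂ)‖ ≤ 1 := by rw [Complex.norm_real, Real.norm_eq_abs]; exact hc
  have hsmall : ‖(fun c => ((L : ℂ) ^ 3)⁻¹ * q' c) (c : ℂ)‖ ≤ δ := HT _ hqd hqM hqD (c : ℂ) hcC
  -- hence `‖Z(c)‖ ≤ exp(δ L³)`
  have hZ : ‖tiltZ n Ψ R (max T₁ T₃) L g c‖ ≤ Real.exp (δ * L ^ 3) := by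
    rw [← hqexp (c : ℂ) (hcC.trans_lt (by norm_num)), Complex.norm_exp]
    apply Real.exp_le_exp.2
    calc ((L : ℂ) ^ 3 * (fun c => ((L : ℂ) ^ 3)⁻¹ * q' c) (c : ℂ)).re
        ≤ ‖(L : ℂ) ^ 3 * (fun c => ((L : ℂ) ^ 3)⁻¹ * q' c) (c : ℂ)‖ := Complex.re_le_norm _
      _ = L ^ 3 * ‖(fun c => ((L : ℂ) ^ 3)⁻¹ * q' c) (c : ℂ)‖ := by
          rw [norm_mul, norm_pow, Complex.norm_real, Real.norm_eq_abs, abs_of_pos hLpos]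
      _ ≤ L ^ 3 * δ := by gcongr
      _ = δ * L ^ 3 := by ring
  -- and at real `c` the crux's left side IS `‖Z(c)‖`
  have key := lintegral_exp_eq_norm_tiltZ (n := n) Ψ (R := R) L hTpos hg.measurable hgb c
  show ∫⁻ z, ENNReal.ofReal (Real.exp (2 * c * ∑ i : Fin n, windowAvg Ψ R (max T₁ T₃) g z i))
      ∂(cellLaw σ n L (Ψ n)) ≤ ENNReal.ofReal (Real.exp (δ * L ^ 3))
  rw [key]
  exact ENNReal.ofReal_le_ofReal hZ

/-- D-0027 §3.3 shape: the crux from the registered stubs — an `example`, so that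
`CellForecastPressureDecay_of` stays the unique theorem concluding the crux; it becomes the proof of
the item once the three `sorry`s are discharged. -/
example : Summit.AtomisticToContinuum.HydrodynamicLimit.Theses.AntiMazurCoboundaries.CellForecastPressureDecay :=
  CellForecastPressureDecay_of Holds.stub_siteSummableLabelCumulants Holds.stub_koteckyPreissLog
    Holds.stub_fixedOrderCumulantDecay

end

end Summit.AtomisticToContinuum.HydrodynamicLimit.Cruxes.CellForecastPressureDecay.TiltAnalyticityTransfer
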